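import Literature.MathematicalPhysics.QuantumFieldTheory.BalabanImbrieJaffe1984to88.BIJ88ScalarTranslation330Torus
import Literature.MathematicalPhysics.QuantumFieldTheory.BalabanImbrieJaffe1984to88.BIJ88BasicForms331
import Literature.MathematicalPhysics.QuantumFieldTheory.BalabanImbrieJaffe1984to88.BIJ88BasicForms331Torus
import Literature.MathematicalPhysics.QuantumFieldTheory.BalabanImbrieJaffe1984to88.BIJ88ScalarForms329Record

/-!
# `BalabanImbrieJaffe1984to88.BIJ88BasicForms331OpsTorus` — T. Bałaban, J. Imbrie, A. Jaffe, *Effective action and cluster properties of the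
abelian Higgs model*, Commun. Math. Phys. **114** (1988) 257–315 [BalabanImbrieJaffe1988], Sect. 3 p. 270 [PDF 14]: **the passage
(3.29) → (3.30) → (3.31) AT THE OBJECTS OF RECORD ON THE TORUS** — r16's / p02's §5.8 operator dictionary `BIJ88ScalarSummary583.Ops`
INSTANTIATED at the first step on the realified torus carrier, its Euclidean laws `Ops.Laws` PROVED there, and hence p02's abstract derivation
`BIJ88BasicForms331.eq331` read on the kernels of record: p30's (3.29) record forms at the translated field (3.30) EQUAL r18's typed basic forms
(3.31) plus the *"neglected"* terms made explicit

statement-level skeleton of published theorems with citation tags; proofs where landed; nothing here is a claim about the Yang–Mills mass gap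

PDF held: `paper:balaban1988-cmp114-bij-abelian-higgs-effective-action` (journal page = PDF page + 256).  Renders read this session as images
(`pub-balaban/b2b-balaban-ref1/tools/g4png.py`, seat folder `renders/original-p009-x2.png` = p. 265; `HOME/lit-balaban-r16/renders/cmp114/original-p010/
p011/p012-x2.png` = pp. 266–268); p. 270 [PDF 14] from the predecessor seats' verbatim blocks (r18's `BIJ88BasicForms331Torus`, p02's
`BIJ88BasicForms331`, my gen-34 `BIJ88ScalarTranslation330Torus`).

**What the paper prints (p. 270, verbatim).**  *"The expansion yields for the scalar field forms ½aL⁻²⟨ψ − Q(u)φ, ψ − Q(u)φ⟩ + ½⟨φ, −Δ_uφ⟩ =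
½aL⁻²⟨ψ − Q(u₁)φ, ψ − Q(u₁)φ⟩ + ½⟨φ, −Δ_{u₁}φ⟩ + R^{(0)}(u₁, θ₀A^{(0)}) + Σ_□ W₁^{(0)}(□), (3.29) … The next step is a scalar field translation to
remove the term linear in φ in (3.29). Again we make a local translation, φ = φ^{(0)} + aL⁻²Λ₇^{(0)}C^{(0)}_{loc}(u₁)Q*(u₁)ψ. (3.30)  Neglecting
terms at ∂Λ₇^{(0)} and local terms [range O(r(e₀))] of the order of e^{−cr(e₀)}, we obtain the basic quadratic forms in φ^{(0)} and ψ: ½⟨φ^{(0)},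
(−Δ_{u₁} + aL^{−2}Q(u₁)*Q(u₁))φ^{(0)}⟩ + ½⟨Λ₈^{(0)′}ψ, Δ^L_{1,loc}(u₁)Λ₈^{(0)′}ψ⟩. (3.31)"* (p. 270 [PDF 14], text layer `p0014.txt` L13–17; v1.1: the
sentence before (3.31) re-read from the print — v1.0 carried the inherited paraphrase *«If we neglect … localized terms …»*, referee docfix D-g78-2.)

CITATION HEADER (lean-in-tree rule).  Part of the lit-balaban TYPED SKELETON (HOME `run/shared/lean/pub/lit-balaban/`), PHASE-2 proof seat
p29 gen 35 (`literature-prover-lit-balaban-p29-g35-0`; TAKING line HOME/STATUS.md 2026-08-23T16:59:30Z); rows **C2.Eq3.29 / C2.Eq3.30 /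
C2.Eq3.31** of `HOME/lit-balaban-r18/ROWS-C2.md` (fold owner r18; all three heads already `proved` — this file is a MEMBER, zero head weight).
WHY THIS FILE: r18's `BIJ88BasicForms331Torus` (row C2.Eq3.31) identifies the two kernels of (3.31) at the objects of record but records in its
header, (b): *«NOT asserted: the derivation [print: "Neglecting terms at ∂Λ₇^{(0)} …, we obtain …"] ((3.29)–(3.30) ⟹ (3.31)) — it is p02 gen 5's
`BIJ88BasicForms331.eq331` on the abstract `Ops` carrier (p256984), NOT bridged to these matrices here»*; my gen-34 `BIJ88ScalarTranslation330Torus`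
records the same gap, (ii): *«NOT here: the realified End/Hilbert-carrier instance of r16's `Ops` (so p02's `BIJ88BasicForms331.eq331` is not
instantiated at these kernels)»*.  THIS FILE BUILDS THAT BRIDGE.  v1.1 (p29 gen 36, DOC-ONLY, declarations byte-identical to v1.0 p369225): the
sentence before (3.31) quoted from the print (*"Neglecting terms at ∂Λ₇^{(0)} and local terms [range O(r(e₀))] of the order of e^{−cr(e₀)}, we
obtain"*, p0014 L13–14) in place of the inherited paraphrase — referee ref-5 docfix D-g78-2 (zero weight; mathematics unaffected, `negl331` is explicit).

WHAT IS REPRODUCED (kernel-checked; 0 `sorry`; no `Prop`-valued definition; standard axioms).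
* §1 THE RECTANGULAR REALIFICATION `realify₂ A` of a complex `m × n` matrix (`[[Re A, −Im A],[Im A, Re A]]` in `2 × 2` blocks; on square matrices
  it is p31's `BIJ88Eq240FlatTorus.realify`, `realify₂_eq_realify` by `rfl`) with the inverse real coordinates `reim φ` of p31's `cplx`
  (`cplx_reim`): `cplx_realify₂_mulVec` (it acts as `A` in the coordinates), `dotProduct_realify₂_mulVec` (`vᵀ·realify₂ A·w = Re φ_vᴴ A φ_w`),
  `realify₂_mul`, `realify₂_conjTranspose` (adjoint ↦ transpose), `realify₂_add/sub/smul/one`, `dotProduct_self_eq_sum_norm_sq`.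
* §2 THE REALIFIED EUCLIDEAN CARRIER `E ι = EuclideanSpace ℝ (ι × Fin 2)` (two real coordinates per site; the real Hilbert-space reading (ii) of
  p02's files made CONCRETE: `⟪φ, χ⟫ = Re Σ_x φ̄(x)χ(x)`) and the dictionary `RL A = Matrix.toEuclideanLin (realify₂ A)`: **`inner_RL`**
  (`⟪x, RL A y⟫ = Re φ_xᴴ A φ_y`), **`inner_RL_left`** (`⟪RL A y, x⟫ = ⟪y, RL Aᴴ x⟫` — the adjoint of a complex kernel is its conjugate transpose),
  `RL_mul` / `RL_one` / `RL_add` / `RL_sub` / `RL_smul`, `cplx_ofLp_RL`, `cplx_injective`, `eq_RL_of_cplx` (a real linear map of the carriers whose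
  complex-coordinate action is a kernel `K` IS `RL K`).
* §3 **THE §5.8 DICTIONARY AT STEP 0 ON THE TORUS, `ops330`** (an `Ops (E T^{(j)}) (E T^{(j+1)}) (E T^{(j)})`): `a = ak = κ` (the printed `aL⁻²`;
  at the first step `a₁L⁻² = aL⁻²`), `Λ8 = I` (the (3.29) forms carry no `Λ₈^{(−1)′}`), `Δ = RL(−Δ_{u₁})` (my `lapU c u₁`), `P = RL(Q(u₁)ᴴQ(u₁))`
  (p31's `pOp u₁`), `Λ7 = RL(1_{Λ₇})`, `Λ8' = RL(1_{Λ₈′})` (p31's `proj`), `Q = Q1 = RL(Q(u₁))` (p31's `qMatT u₁ 1`), `Qst = Q1st = RL(Q(u₁)ᴴ)`,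
  `C = G = RL((−Δ_{u₁} + κQ(u₁)ᴴQ(u₁))⁻¹)` (`C^{(0)}(u₁) = G^η_1(u₁)`: p31's `nOp κ c u₁ 1 univ`, inverted), `Cloc = RL(C^{(0)}_{Λ,loc}(u₁))`
  (my (2.43) kernel `cLocC Λ (nOp κ c u₁ 1 univ) M ρ`), `Tst = κ • RL((1_{Λ₇}C^{(0)}_{Λ,loc}Q(u₁)ᴴ)ᴴ)`, `Gloc = RL(G_{1,loc}(u₁))` (p31's (2.28)
  `gLocT κ c u₁ 1 cube lam ζ″`).  **`ops330_laws : (ops330 …).Laws`** — the nine Euclidean laws PROVED: symmetry of `Δ`, `Λ₈′` from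
  `lapU_isHermitian` / `proj_conjTranspose`, the adjoint pairs `(Q, Q*)`, `(T, T*)` from `inner_RL_left`, `⟨Qx, Qy⟩ = ⟨x, Py⟩` from `P = QᴴQ`,
  and the identity of [7] (`Laws.ident`) DEFINITIONALLY: at the first step both sides are the same operator (`a₁L⁻² = aL⁻²`, `Q₁ = Q(u₁)`,
  `G^η_1(u₁) = C^{(0)}(u₁)`).  Dictionaries: `T_eq` / `cplx_T_apply` (p02's translation `Ops.T = a•(Λ7∘Cloc∘Qst)` IS `κ·RL(1_{Λ₇}·C_{Λ,loc}·Qᴴ)`),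
  **`cplx_transl_eq_phi330`** (`φ^{(0)} + Tψ` read in complex coordinates IS r18's typed (3.30) `phi330 Λ₇ a L φ⁰ (corr330 …)` with my gen-34
  correction `corr330`), `deltaLloc_eq_RL_deltaLocT` (p02's `Δ^L_{1,loc} = ak•I − ak²•Q1∘Gloc∘Q1st` IS `RL` of p31's (2.34) `deltaLocT κ c u₁ 1 …`).
* §4 **(3.29) → (3.30) → (3.31) ON THE TORUS**: `negl331` := p02's neglected terms `𝒬₅ + 𝒬₆ + ⟨φ⁰, w₆ψ⟩ + ½⟨ψ, w₇ψ⟩` (the *"terms at ∂Λ₇^{(0)} and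
  local terms [range O(r(e₀))] of the order of e^{−cr(e₀)}"*, in the explicit forms of `BIJ88ScalarSummary583`) AT the instance; **`eq331_torus`**: for every
  `U(1)` field `u₁ = cfg U`, all fields `φ⁰`, `ψ`, `½Σ_b‖(D_{u₁}φ)(b)‖² + ½κΣ_y‖ψ(y) − (Q(u₁)φ)(y)‖²` at `φ = phi330 Λ₇ a L φ⁰ (corr330 Λ κ c U M ρ ψ)`,
  `κ = aL⁻²`, EQUALS r18's `basicForms331 (nOp κ c u₁ 1 univ) (deltaLocT κ c u₁ 1 cube lam ζ″) Λ₈′ φ⁰ ψ + negl331 …`; **`eq331_record`** — the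
  same with the left side LITERALLY p30's (3.29) record `BIJ88Sect3Translations.scalarForms a L qRec lapRec (cfg U) φ ψ` (`c = 1`).
* §5 KERNEL FORMULAS for two of the neglected kernels (p02's `w6 = (Λ8ΔΛ8T − aQ*(1 − QT))Λ8'` and `w7'' = Λ8'·locDefect·Λ8'` at the instance ARE
  `RL` of explicit complex kernels: `w6_eq_RL` / `w7''_eq_RL`, via `eq_RL_of_cplx`): **`inner_w6_eq`** — `⟨φ⁰, w₆ψ⟩ = Re φ⁰ᴴ·w6Ker·ψ` with the print
  shape **`w6Ker_eq`**: `w6Ker = κ[(−Δ_{u₁} + κQᴴQ)1_{Λ₇}C^{(0)}_{Λ,loc} − 1]Q(u₁)ᴴ1_{Λ₈′}` (it vanishes when `Λ₇ = T` and the local kernel is an exact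
  inverse: *"(5.8.1) would eliminate entirely the linear term were it not for the localizations"*, `w6Ker_shape_exact`), and **`inner_w7''_eq`** —
  `⟨ψ, w₇″ψ⟩ = Re ψᴴ·w7''Ker·ψ` with **`w7''Ker_eq`**: `w7''Ker = κ²1_{Λ₈′}Q(u₁)(G_{1,loc}(u₁) − C^{(0)}_{Λ,loc}(u₁))Q(u₁)ᴴ1_{Λ₈′}` (at the first step the
  localization defect of the identity of [7] is the DIFFERENCE OF THE TWO LOCALIZATIONS of the one propagator `C^{(0)}(u₁) = G^η_1(u₁)`: the
  random-walk one (2.43) in the translation and the cube-Neumann one (2.27)–(2.28) in `Δ^L_{1,loc}`; `w7''Ker_eq_zero_of_eq`).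

HONEST SCOPE.  (i) The sizes *"of the order of e^{−cr(e₀)}"* / *"small kernel with range less than r(e_k)"* of the neglected terms are NOT
claimed (rows (2.31)/(2.35)/(2.47) and p27's (3.33) files carry the sizes of the ingredients); `negl331` is an explicit real number, not a bound.
(ii) Real Hilbert-space reading: `⟨·,·⟩` of pp. 270/295–296 = `Re` of the Hermitian pairing of complex site functions, uniform weights (the tree's
convention for `Q(u)ᴴ`, p31 gen 10; r18's `basicForms331` and p30's record use the same `Re`/norm-square reading).  (iii) At the first step the
identity of [7] is definitional (see §3); the general-`k` instance (a₊ = aa_k/(aL⁻² + a_k), [7] (2.13), p02's `BIJ88IdentityB1p296Proof` on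
`B1RG242.StepData`) is NOT built here.  (iv) The Dirichlet region `Λ` of (2.40)/(2.43), the walk data `M`, `ρ`, the translation region `Λ₇`, the
decimated region `Λ₈′`, and the (2.27)–(2.29) data `cube`/`lam`/`ζ″` are free parameters, as in the files of record.  (v) Torus (periodic b.c.),
`U(1)`, any `d ≥ 1`.  Imports Literature only; re-declares nothing (`Ops`, `Ops.Laws`, `eq331`, `scalarForms` (both), `basicForms331`, `phi330`,
`corr330`, `cLocC`, `lapU`, `nOp`, `pOp`, `proj`, `qMatT`, `deltaLocT`, `gLocT`, `realify`, `cplx`, `qRec`, `lapRec` BY NAME); NOT summit progress;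
NOT continuum; NOT Clay.
-/

open scoped BigOperators Matrix ComplexConjugate RealInnerProductSpace
open Finset Matrix

namespace Literature.MathematicalPhysics.QuantumFieldTheory.BalabanImbrieJaffe1984to88.BIJ88BasicForms331OpsTorus

open Literature.MathematicalPhysics.QuantumFieldTheory.Balaban1983to89
open BIJ88Sect3Statements (U1 toC cfg covD)
open BIJ88Sect3Translations (phi330 basicForms331)
open BIJ85BlockAveragesTorus (qCov)
open BIJ85BlockAveragesTorusK (qCovK qCovK_one)
open BIJ88NeumannPropagator227Torus (nOp nOp_eq nOp_conjTranspose proj proj_mulVec proj_conjTranspose)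
open BIJ88DeltaLoc234Torus (qMatT qMatT_mulVec deltaLocT gLocT)
open BIJ88Eq240FlatTorus (realify cplx cplx_realify_mulVec dotProduct_eq_re pOp op240)
open BIJ88Decay241FlatTorus (realify_one)
open BIJ88ScalarTranslation330Torus (lapU lapU_isHermitian form_lapU nOp_univ_eq_op240 re_form_nOp_univ cLocC corr330
  phi330_corr330_eq_mulVec)
open BIJ88ScalarForms329Record (qRec lapRec scalarForms_record_cfg)
open BIJ88BasicForms331Torus (sum_sum_conj_mul_eq sum_sum_restrict_eq)
open BIJ88ScalarSummary583 (Ops)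

noncomputable section

/-! ## §1  The rectangular realification and the real coordinates -/

section Realify2

variable {m n l : Type*}

/-- **The realification of a complex `m × n` kernel**: the real `2|m| × 2|n|` matrix `[[Re A, −Im A],[Im A, Re A]]` of `φ ↦ Aφ` in the real
coordinates `cplx` (two per site) — the rectangular version of p31's `BIJ88Eq240FlatTorus.realify` (needed for the block averages `Q(u)`, which map
fine-lattice fields to block fields). [cite: BalabanImbrieJaffe1988, (4.9) p.275] -/
def realify₂ (A : Matrix m n ℂ) : Matrix (m × Fin 2) (n × Fin 2) ℝ :=
  Matrix.of fun p q =>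
    if p.2 = 0 then (if q.2 = 0 then (A p.1 q.1).re else -(A p.1 q.1).im)
    else (if q.2 = 0 then (A p.1 q.1).im else (A p.1 q.1).re)

/-- kernel: on square matrices the rectangular realification IS p31's `realify`. [cite: BalabanImbrieJaffe1988, (4.9) p.275] -/
theorem realify₂_eq_realify (A : Matrix n n ℂ) : realify₂ A = realify A := rfl

/-- kernel: the entries of `realify₂`. [cite: BalabanImbrieJaffe1988, (4.9) p.275] -/
theorem realify₂_apply (A : Matrix m n ℂ) (p : m × Fin 2) (q : n × Fin 2) :
    realify₂ A p q = if p.2 = 0 then (if q.2 = 0 then (A p.1 q.1).re else -(A p.1 q.1).im)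
      else (if q.2 = 0 then (A p.1 q.1).im else (A p.1 q.1).re) := rfl

/-- **The real coordinates of a complex field** (inverse of p31's `cplx`): `reim φ (x, 0) = Re φ(x)`, `reim φ (x, 1) = Im φ(x)`.
[cite: BalabanImbrieJaffe1988, (4.9) p.275] -/
def reim (φ : n → ℂ) : n × Fin 2 → ℝ := fun p => if p.2 = 0 then (φ p.1).re else (φ p.1).im

/-- kernel: `cplx (reim φ) = φ`. [cite: BalabanImbrieJaffe1988, (4.9) p.275] -/
theorem cplx_reim (φ : n → ℂ) : cplx (reim φ) = φ := by
  funext i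
  apply Complex.ext
  · simp [cplx, reim]
  · simp [cplx, reim]

/-- kernel: `reim (cplx v) = v`. [cite: BalabanImbrieJaffe1988, (4.9) p.275] -/
theorem reim_cplx (v : n × Fin 2 → ℝ) : reim (cplx v) = v := by
  funext p
  obtain ⟨i, a⟩ := p
  fin_cases a
  · simp [cplx, reim]
  · simp [cplx, reim]

/-- kernel: `cplx` is additive. [cite: BalabanImbrieJaffe1988, (4.9) p.275] -/
theorem cplx_add (v w : n × Fin 2 → ℝ) : cplx (v + w) = cplx v + cplx w := by
  funext i
  apply Complex.ext
  · simp [cplx]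
  · simp [cplx]

/-- kernel: `cplx` commutes with subtraction. [cite: BalabanImbrieJaffe1988, (4.9) p.275] -/
theorem cplx_sub (v w : n × Fin 2 → ℝ) : cplx (v - w) = cplx v - cplx w := by
  funext i
  apply Complex.ext
  · simp [cplx]
  · simp [cplx]

/-- kernel: `cplx` is real-homogeneous. [cite: BalabanImbrieJaffe1988, (4.9) p.275] -/
theorem cplx_smul (s : ℝ) (v : n × Fin 2 → ℝ) : cplx (s • v) = (s : ℂ) • cplx v := by
  funext i
  apply Complex.ext
  · simp [cplx]
  · simp [cplx]

/-- kernel: **the realified kernel acts as `A` in the coordinates**: `cplx (realify₂ A · v) = A · cplx v` (p31's `cplx_realify_mulVec`, rectangular).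
[cite: BalabanImbrieJaffe1988, (4.9) p.275] -/
theorem cplx_realify₂_mulVec [Fintype n] (A : Matrix m n ℂ) (v : n × Fin 2 → ℝ) : cplx (realify₂ A *ᵥ v) = A *ᵥ cplx v := by
  funext i
  apply Complex.ext
  · rw [cplx]
    simp only [mulVec, dotProduct, Complex.re_sum, Complex.mul_re]
    rw [Fintype.sum_prod_type]
    refine sum_congr rfl fun k _ => ?_
    rw [Fin.sum_univ_two, realify₂, of_apply, of_apply]
    simp only [↓reduceIte, Fin.isValue, one_ne_zero, cplx]
    ring
  · rw [cplx]
    simp only [mulVec, dotProduct, Complex.im_sum, Complex.mul_im]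
    rw [Fintype.sum_prod_type]
    refine sum_congr rfl fun k _ => ?_
    rw [Fin.sum_univ_two, realify₂, of_apply, of_apply]
    simp only [↓reduceIte, Fin.isValue, one_ne_zero, cplx]
    ring

/-- kernel: **`vᵀ·realify₂ A·w = Re φ_vᴴ A φ_w`** — the real pairing against the realified kernel is the real part of the Hermitian pairing (p31's
`dotProduct_realify_mulVec`, rectangular). [cite: BalabanImbrieJaffe1988, (4.9) p.275] -/
theorem dotProduct_realify₂_mulVec [Fintype m] [Fintype n] (A : Matrix m n ℂ) (v : m × Fin 2 → ℝ) (w : n × Fin 2 → ℝ) :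
    v ⬝ᵥ (realify₂ A *ᵥ w) = (star (cplx v) ⬝ᵥ (A *ᵥ cplx w)).re := by
  rw [dotProduct_eq_re, cplx_realify₂_mulVec]

/-- kernel: `vᵀv = Σ_x ‖φ_v(x)‖²`. [cite: BalabanImbrieJaffe1988, (4.9) p.275] -/
theorem dotProduct_self_eq_sum_norm_sq [Fintype n] (v : n × Fin 2 → ℝ) : v ⬝ᵥ v = ∑ i, ‖cplx v i‖ ^ 2 := by
  rw [dotProduct, Fintype.sum_prod_type]
  refine sum_congr rfl fun i _ => ?_
  rw [Fin.sum_univ_two, Complex.sq_norm, Complex.normSq_apply, cplx]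

/-- kernel: **the realification is multiplicative** (rectangular; p31's `realify_mul` is the square case). [cite: BalabanImbrieJaffe1988, (4.9) p.275] -/
theorem realify₂_mul [Fintype n] (A : Matrix m n ℂ) (B : Matrix n l ℂ) : realify₂ (A * B) = realify₂ A * realify₂ B := by
  ext p q
  obtain ⟨i, a⟩ := p
  obtain ⟨k, b⟩ := q
  rw [mul_apply, Fintype.sum_prod_type]
  simp only [Fin.sum_univ_two, realify₂, of_apply, mul_apply, Fin.isValue]
  fin_cases a <;> fin_cases b
  all_goals simp only [Fin.isValue, Fin.zero_eta, Fin.mk_one, ↓reduceIte, one_ne_zero, Complex.re_sum, Complex.im_sum,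
    ← Finset.sum_neg_distrib]
  all_goals exact Finset.sum_congr rfl fun j _ => by simp only [Complex.mul_re, Complex.mul_im]; ring

/-- kernel: **the realification of the adjoint is the transpose** (rectangular; the square case is `BIJ88BgInvariance416Torus.realify_conjTranspose`).
[cite: BalabanImbrieJaffe1988, (4.9) p.275] -/
theorem realify₂_conjTranspose (A : Matrix m n ℂ) : realify₂ Aᴴ = (realify₂ A)ᵀ := by
  ext p q
  obtain ⟨i, a⟩ := p
  obtain ⟨k, b⟩ := q
  rw [transpose_apply, realify₂_apply, realify₂_apply, conjTranspose_apply]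
  simp only
  fin_cases a <;> fin_cases b <;> simp [Complex.conj_re, Complex.conj_im]

/-- kernel: additivity of the realification. [cite: BalabanImbrieJaffe1988, (4.9) p.275] -/
theorem realify₂_add (A B : Matrix m n ℂ) : realify₂ (A + B) = realify₂ A + realify₂ B := by
  ext p q
  simp only [realify₂_apply, Matrix.add_apply, Complex.add_re, Complex.add_im]
  split_ifs <;> ring

/-- kernel: the realification commutes with subtraction. [cite: BalabanImbrieJaffe1988, (4.9) p.275] -/
theorem realify₂_sub (A B : Matrix m n ℂ) : realify₂ (A - B) = realify₂ A - realify₂ B := by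
  ext p q
  simp only [realify₂_apply, Matrix.sub_apply, Complex.sub_re, Complex.sub_im]
  split_ifs <;> ring

/-- kernel: real homogeneity of the realification. [cite: BalabanImbrieJaffe1988, (4.9) p.275] -/
theorem realify₂_smul (s : ℝ) (A : Matrix m n ℂ) : realify₂ ((s : ℂ) • A) = s • realify₂ A := by
  ext p q
  simp only [realify₂_apply, Matrix.smul_apply, smul_eq_mul, Complex.re_ofReal_mul, Complex.im_ofReal_mul]
  split_ifs <;> ring

/-- kernel: the realification is unital (p31's `realify_one`). [cite: BalabanImbrieJaffe1988, (4.9) p.275] -/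
theorem realify₂_one [DecidableEq n] : realify₂ (1 : Matrix n n ℂ) = 1 := by
  rw [realify₂_eq_realify]
  exact realify_one

end Realify2

/-! ## §2  The realified Euclidean carrier and the dictionary `RL` -/

section Carrier

variable {m n l : Type*}

/-- **The realified carrier**: complex site functions on `ι` as the REAL Euclidean space of their real coordinates (two per site) — the
*"real Hilbert-space reading"* of `⟨·,·⟩` in p02's (5.8.1)–(5.8.3) / (3.31) files made concrete: `⟪φ, χ⟫ = Re Σ_x φ̄(x)χ(x)`.
[cite: BalabanImbrieJaffe1988, (3.31) p.270] -/
abbrev E (ι : Type*) : Type _ := EuclideanSpace ℝ (ι × Fin 2)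

/-- **The complex kernel `A` as a real linear map of the realified carriers**: `RL A = Matrix.toEuclideanLin (realify₂ A)`.
[cite: BalabanImbrieJaffe1988, (3.31) p.270] -/
def RL [Fintype n] [DecidableEq n] (A : Matrix m n ℂ) : E n →ₗ[ℝ] E m := Matrix.toEuclideanLin (realify₂ A)

/-- kernel: the coordinates of `RL A x`. [cite: BalabanImbrieJaffe1988, (3.31) p.270] -/
theorem ofLp_RL [Fintype n] [DecidableEq n] (A : Matrix m n ℂ) (x : E n) : WithLp.ofLp (RL A x) = realify₂ A *ᵥ WithLp.ofLp x := rfl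

/-- kernel: in complex coordinates `RL A` acts as `A`. [cite: BalabanImbrieJaffe1988, (3.31) p.270] -/
theorem cplx_ofLp_RL [Fintype n] [DecidableEq n] (A : Matrix m n ℂ) (x : E n) :
    cplx (WithLp.ofLp (RL A x)) = A *ᵥ cplx (WithLp.ofLp x) := by
  rw [ofLp_RL, cplx_realify₂_mulVec]

/-- kernel: the real inner product of the carrier is the coordinate pairing. [cite: BalabanImbrieJaffe1988, (3.31) p.270] -/
theorem inner_eq_dotProduct [Fintype n] (x y : E n) : ⟪x, y⟫ = WithLp.ofLp x ⬝ᵥ WithLp.ofLp y := by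
  rw [EuclideanSpace.inner_eq_star_dotProduct, star_trivial, dotProduct_comm]

/-- kernel: **`⟪x, RL A y⟫ = Re φ_xᴴ A φ_y`** — the real pairing against `RL A` is the real part of the Hermitian pairing of the complex fields.
[cite: BalabanImbrieJaffe1988, (3.31) p.270] -/
theorem inner_RL [Fintype m] [Fintype n] [DecidableEq n] (A : Matrix m n ℂ) (x : E m) (y : E n) :
    ⟪x, RL A y⟫ = (star (cplx (WithLp.ofLp x)) ⬝ᵥ (A *ᵥ cplx (WithLp.ofLp y))).re := by
  rw [inner_eq_dotProduct, ofLp_RL, dotProduct_realify₂_mulVec]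

/-- kernel: `⟪x, x⟫ = Σ_x ‖φ_x(x)‖²`. [cite: BalabanImbrieJaffe1988, (3.31) p.270] -/
theorem inner_self_eq_sum_norm_sq [Fintype n] (x : E n) : ⟪x, x⟫ = ∑ i, ‖cplx (WithLp.ofLp x) i‖ ^ 2 := by
  rw [inner_eq_dotProduct, dotProduct_self_eq_sum_norm_sq]

/-- kernel: **the adjoint of `RL A` is `RL Aᴴ`**: `⟪RL A y, x⟫ = ⟪y, RL Aᴴ x⟫`. [cite: BalabanImbrieJaffe1988, (3.31) p.270] -/
theorem inner_RL_left [Fintype m] [DecidableEq m] [Fintype n] [DecidableEq n] (A : Matrix m n ℂ) (y : E n) (x : E m) :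
    ⟪RL A y, x⟫ = ⟪y, RL Aᴴ x⟫ := by
  rw [real_inner_comm, inner_eq_dotProduct, inner_eq_dotProduct, ofLp_RL, ofLp_RL, realify₂_conjTranspose, dotProduct_mulVec,
    ← mulVec_transpose, dotProduct_comm]

/-- kernel: `RL` is multiplicative: `RL (AB) = RL A ∘ RL B`. [cite: BalabanImbrieJaffe1988, (3.31) p.270] -/
theorem RL_mul [Fintype n] [DecidableEq n] [Fintype l] [DecidableEq l] (A : Matrix m n ℂ) (B : Matrix n l ℂ) :
    RL (A * B) = RL A ∘ₗ RL B := by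
  rw [RL, realify₂_mul]
  exact Matrix.toLpLin_mul_same 2 _ _

/-- kernel: `RL 1 = id`. [cite: BalabanImbrieJaffe1988, (3.31) p.270] -/
theorem RL_one [Fintype n] [DecidableEq n] : RL (1 : Matrix n n ℂ) = LinearMap.id := by
  rw [RL, realify₂_one]
  exact Matrix.toLpLin_one 2

/-- kernel: `RL` is additive. [cite: BalabanImbrieJaffe1988, (3.31) p.270] -/
theorem RL_add [Fintype n] [DecidableEq n] (A B : Matrix m n ℂ) : RL (A + B) = RL A + RL B := by
  rw [RL, realify₂_add, map_add]
  rfl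

/-- kernel: `RL` commutes with subtraction. [cite: BalabanImbrieJaffe1988, (3.31) p.270] -/
theorem RL_sub [Fintype n] [DecidableEq n] (A B : Matrix m n ℂ) : RL (A - B) = RL A - RL B := by
  rw [RL, realify₂_sub, map_sub]
  rfl

/-- kernel: `RL` is real-homogeneous: `RL (s·A) = s·RL A`. [cite: BalabanImbrieJaffe1988, (3.31) p.270] -/
theorem RL_smul [Fintype n] [DecidableEq n] (s : ℝ) (A : Matrix m n ℂ) : RL ((s : ℂ) • A) = s • RL A := by
  rw [RL, realify₂_smul, map_smul]
  rfl

/-- kernel: `cplx` is injective (its left inverse is `reim`). [cite: BalabanImbrieJaffe1988, (4.9) p.275] -/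
theorem cplx_injective : Function.Injective (cplx : (n × Fin 2 → ℝ) → n → ℂ) := fun v w h => by
  rw [← reim_cplx v, ← reim_cplx w, h]

/-- kernel: **a real linear map of the carriers whose complex-coordinate action is the kernel `K` IS `RL K`** (used to identify p02's residual
kernels with explicit matrices). [cite: BalabanImbrieJaffe1988, (3.31) p.270] -/
theorem eq_RL_of_cplx [Fintype n] [DecidableEq n] (f : E n →ₗ[ℝ] E m) (K : Matrix m n ℂ)
    (h : ∀ x, cplx (WithLp.ofLp (f x)) = K *ᵥ cplx (WithLp.ofLp x)) : f = RL K := by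
  refine LinearMap.ext fun x => WithLp.ofLp_injective 2 (cplx_injective ?_)
  rw [h, cplx_ofLp_RL]

end Carrier

/-! ## §3  The §5.8 dictionary `Ops` at step 0 on the torus, and its laws -/

section Dictionary

variable {P : Params} {j : ℕ} {ι : Type*} [Fintype ι]

/-- **THE §5.8 OPERATOR DICTIONARY AT THE FIRST STEP, ON THE REALIFIED TORUS CARRIER** (p. 270 read through pp. 295–296): `a = ak = κ` (`κ` = the
printed `aL⁻²`; `a₁L⁻² = aL⁻²` at the first step), `Λ8 = I`, `Δ = −Δ_{u₁}`, `P = Q(u₁)*Q(u₁)`, `Λ7 = 1_{Λ₇}`, `C = C^{(0)}(u₁) = (−Δ_{u₁} +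
κQ(u₁)*Q(u₁))⁻¹`, `Cloc = C^{(0)}_{Λ,loc}(u₁)` ((2.43), walk data `M`, `ρ`), `Q = Q(u₁)`, `Qst = Q(u₁)*`, `Tst` = the adjoint of the (3.30) shift
`T = κ·1_{Λ₇}C^{(0)}_{Λ,loc}Q(u₁)*`, `Λ8' = 1_{Λ₈′}`, and for `Δ^L_{1,loc}(u₁)` ((2.34) at `k = 1`): `Q1 = Q(u₁)`, `Q1st = Q(u₁)*`, `G = G^η_1(u₁) =
C^{(0)}(u₁)`, `Gloc = G_{1,loc}(u₁)` ((2.27)–(2.28), data `cube`, `lam`, `ζ″`) — every slot the `RL` of the matrix of record.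
[cite: BalabanImbrieJaffe1988, (3.31) p.270] -/
def ops330 (Λ Λ₇ : Finset (Balaban1983to89.Site P j)) (Λ₈' : Finset (Balaban1983to89.Site P (j + 1))) (κ c : ℝ) (U : GaugeField P j U1)
    (M : ℕ) (ρ : ℝ) (cube : ι → Finset (Balaban1983to89.Site P j))
    (lam : ι → Balaban1983to89.Site P j → Balaban1983to89.Site P j → ℝ) (ζ'' : Balaban1983to89.Site P j → Balaban1983to89.Site P j → ℝ) :
    Ops (E (Balaban1983to89.Site P j)) (E (Balaban1983to89.Site P (j + 1))) (E (Balaban1983to89.Site P j)) where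
  a := κ
  ak := κ
  Λ8 := LinearMap.id
  Δ := RL (lapU c U)
  P := RL (pOp U)
  Λ7 := RL (proj Λ₇)
  C := RL (nOp κ c U 1 univ)⁻¹
  Cloc := RL (cLocC Λ (nOp κ c U 1 univ) M ρ)
  Q := RL (qMatT U 1)
  Qst := RL (qMatT U 1)ᴴ
  Tst := κ • RL (proj Λ₇ * cLocC Λ (nOp κ c U 1 univ) M ρ * (qMatT U 1)ᴴ)ᴴ
  Λ8' := RL (proj Λ₈')
  Q1 := RL (qMatT U 1)
  Q1st := RL (qMatT U 1)ᴴ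
  G := RL (nOp κ c U 1 univ)⁻¹
  Gloc := RL (gLocT κ c U 1 cube lam ζ'')

variable (Λ Λ₇ : Finset (Balaban1983to89.Site P j)) (Λ₈' : Finset (Balaban1983to89.Site P (j + 1))) (κ c : ℝ) (U : GaugeField P j U1)
  (M : ℕ) (ρ : ℝ) (cube : ι → Finset (Balaban1983to89.Site P j))
  (lam : ι → Balaban1983to89.Site P j → Balaban1983to89.Site P j → ℝ) (ζ'' : Balaban1983to89.Site P j → Balaban1983to89.Site P j → ℝ)

/-- **p02's translation `Ops.T = a•(Λ7 ∘ Cloc ∘ Qst)` at the instance is `κ·RL(1_{Λ₇}·C^{(0)}_{Λ,loc}(u₁)·Q(u₁)ᴴ)`** — the (3.30) shift as ONE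
realified kernel. [cite: BalabanImbrieJaffe1988, (3.30) p.270] -/
theorem T_eq : (ops330 Λ Λ₇ Λ₈' κ c U M ρ cube lam ζ'').T = κ • RL (proj Λ₇ * cLocC Λ (nOp κ c U 1 univ) M ρ * (qMatT U 1)ᴴ) := by
  rw [RL_mul, RL_mul]
  rfl

/-- kernel: the translation in complex coordinates: `φ_{Tψ} = κ·(1_{Λ₇}·C^{(0)}_{Λ,loc}·Q(u₁)ᴴ)ψ`. [cite: BalabanImbrieJaffe1988, (3.30) p.270] -/
theorem cplx_T_apply (Ψ : E (Balaban1983to89.Site P (j + 1))) :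
    cplx (WithLp.ofLp ((ops330 Λ Λ₇ Λ₈' κ c U M ρ cube lam ζ'').T Ψ)) =
      (κ : ℂ) • ((proj Λ₇ * cLocC Λ (nOp κ c U 1 univ) M ρ * (qMatT U 1)ᴴ) *ᵥ cplx (WithLp.ofLp Ψ)) := by
  rw [T_eq, LinearMap.smul_apply, WithLp.ofLp_smul, cplx_smul, cplx_ofLp_RL]

/-- **`φ⁰ + Tψ` IN COMPLEX COORDINATES IS r18's TYPED (3.30)** *"φ = φ^{(0)} + aL^{−2}Λ₇^{(0)}C^{(0)}_{loc}(u₁)Q*(u₁)ψ"* at my gen-34 composed correction: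
`cplx(φ⁰ + Tψ) = phi330 Λ₇ a L φ⁰ (corr330 Λ (aL⁻²) c u₁ M ρ ψ)` (`κ = aL⁻²`; `phi330_corr330_eq_mulVec`). [cite: BalabanImbrieJaffe1988, (3.30) p.270] -/
theorem cplx_transl_eq_phi330 (a L : ℝ) (Φ0 : E (Balaban1983to89.Site P j)) (Ψ : E (Balaban1983to89.Site P (j + 1))) :
    cplx (WithLp.ofLp (Φ0 + (ops330 Λ Λ₇ Λ₈' (a * L ^ (-(2 : ℤ))) c U M ρ cube lam ζ'').T Ψ)) =
      phi330 Λ₇ a L (cplx (WithLp.ofLp Φ0)) (corr330 Λ (a * L ^ (-(2 : ℤ))) c U M ρ (cplx (WithLp.ofLp Ψ))) := by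
  rw [WithLp.ofLp_add, cplx_add, cplx_T_apply, phi330_corr330_eq_mulVec]

/-- **p02's `Δ^L_{1,loc} = ak•I − ak²•(Q1 ∘ Gloc ∘ Q1st)` at the instance IS p31's (2.34) `Δ_{1,loc}(u₁) = deltaLocT κ c u₁ 1 cube lam ζ″`**
(`= κ·1 − κ²·Q(u₁)G_{1,loc}(u₁)Q(u₁)ᴴ`), realified. [cite: BalabanImbrieJaffe1988, (2.34) p.263] -/
theorem deltaLloc_eq_RL_deltaLocT :
    (ops330 Λ Λ₇ Λ₈' κ c U M ρ cube lam ζ'').deltaLloc = RL (deltaLocT κ c U 1 cube lam ζ'') := by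
  have hsq : ((κ : ℂ) ^ 2) = ((κ ^ 2 : ℝ) : ℂ) := by push_cast; ring
  rw [deltaLocT, hsq, RL_sub, RL_smul, RL_smul, RL_one, RL_mul, RL_mul]
  rfl

/-- **THE EUCLIDEAN LAWS OF THE DICTIONARY HOLD ON THE TORUS** (`Ops.Laws`): `Δ = RL(−Δ_{u₁})` and `Λ8' = RL(1_{Λ₈′})` are symmetric (Hermitian
kernels: `lapU_isHermitian`, `proj_conjTranspose`), `Λ8 = I` is a symmetric idempotent commuting with `P`, `⟪Qx, Qy⟫ = ⟪x, Py⟫` (`P = Q(u₁)ᴴQ(u₁)`),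
`(Q, Q*)` and `(T, T*)` are adjoint pairs (`inner_RL_left`), and the identity of [7] `a•I − a²•QCQ* = ak•I − ak²•Q1GQ1*` holds by `rfl` (at the first
step both sides are the same operator). [cite: BalabanImbrieJaffe1988, (3.31) p.270] -/
theorem ops330_laws : (ops330 Λ Λ₇ Λ₈' κ c U M ρ cube lam ζ'').Laws where
  Δsym x y := by
    show ⟪RL (lapU c U) x, y⟫ = ⟪x, RL (lapU c U) y⟫
    rw [inner_RL_left, (lapU_isHermitian c U).eq]
  Λ8sym _ _ := rfl
  Λ8idem _ := rfl
  Λ8P _ := rfl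
  Padj x y := by
    show ⟪RL (qMatT U 1) x, RL (qMatT U 1) y⟫ = ⟪x, RL (pOp U) y⟫
    rw [inner_RL_left, ← LinearMap.comp_apply, ← RL_mul]
    rfl
  Qadj x y := by
    show ⟪RL (qMatT U 1) x, y⟫ = ⟪x, RL (qMatT U 1)ᴴ y⟫
    exact inner_RL_left _ _ _
  Tadj y x := by
    show ⟪(ops330 Λ Λ₇ Λ₈' κ c U M ρ cube lam ζ'').T y, x⟫ =
      ⟪y, (κ • RL (proj Λ₇ * cLocC Λ (nOp κ c U 1 univ) M ρ * (qMatT U 1)ᴴ)ᴴ) x⟫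
    rw [T_eq, LinearMap.smul_apply, LinearMap.smul_apply, real_inner_smul_left, real_inner_smul_right, inner_RL_left]
  Λ8'sym u v := by
    show ⟪RL (proj Λ₈') u, v⟫ = ⟪u, RL (proj Λ₈') v⟫
    rw [inner_RL_left, proj_conjTranspose]
  ident := rfl

end Dictionary

/-! ## §4  (3.29) → (3.30) → (3.31) on the torus -/

section Main

variable {P : Params} {j : ℕ} {ι : Type*} [Fintype ι]
variable (Λ Λ₇ : Finset (Balaban1983to89.Site P j)) (Λ₈' : Finset (Balaban1983to89.Site P (j + 1))) (κ c : ℝ) (U : GaugeField P j U1)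
  (M : ℕ) (ρ : ℝ) (cube : ι → Finset (Balaban1983to89.Site P j))
  (lam : ι → Balaban1983to89.Site P j → Balaban1983to89.Site P j → ℝ) (ζ'' : Balaban1983to89.Site P j → Balaban1983to89.Site P j → ℝ)

/-- the realified vector of a complex field (its real coordinates as a point of the carrier). [cite: BalabanImbrieJaffe1988, (3.31) p.270] -/
def toE {n : Type*} (φ : n → ℂ) : E n := WithLp.toLp 2 (reim φ)

/-- kernel: the complex coordinates of `toE φ` are `φ`. [cite: BalabanImbrieJaffe1988, (3.31) p.270] -/
theorem cplx_ofLp_toE {n : Type*} (φ : n → ℂ) : cplx (WithLp.ofLp (toE φ)) = φ := by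
  rw [toE, WithLp.ofLp_toLp, cplx_reim]

/-- **THE NEGLECTED TERMS OF p. 270 MADE EXPLICIT** — *"Neglecting terms at ∂Λ₇^{(0)} and local terms [range O(r(e₀))] of the order of e^{−cr(e₀)}"*: the real
number `𝒬₅ + 𝒬₆ + ⟨φ⁰, w₆ψ⟩ + ½⟨ψ, w₇ψ⟩` of p02's `BIJ88ScalarSummary583` (the forms localized near `Λ₈′ᶜ` and the two residual kernels, in the
explicit forms `Ops.Q5`, `Ops.Q6`, `Ops.w6`, `Ops.w7 = w7' + w7''`) EVALUATED AT THE TORUS DICTIONARY `ops330`; their sizes are not claimed.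
[cite: BalabanImbrieJaffe1988, (3.31) p.270] -/
def negl331 (φ0 : Balaban1983to89.Site P j → ℂ) (ψ : Balaban1983to89.Site P (j + 1) → ℂ) : ℝ :=
  (ops330 Λ Λ₇ Λ₈' κ c U M ρ cube lam ζ'').Q5 (toE φ0) (toE ψ) + (ops330 Λ Λ₇ Λ₈' κ c U M ρ cube lam ζ'').Q6 (toE ψ)
    + ⟪toE φ0, (ops330 Λ Λ₇ Λ₈' κ c U M ρ cube lam ζ'').w6 (toE ψ)⟫
    + (1 / 2) * ⟪toE ψ, (ops330 Λ Λ₇ Λ₈' κ c U M ρ cube lam ζ'').w7 (toE ψ)⟫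

/-- kernel: the left side of p02's `eq331` at the instance, in complex coordinates: `½Σ_b‖(D_{u₁}φ)(b)‖² + ½κΣ_y‖ψ(y) − (Q(u₁)φ)(y)‖²` at
`φ = cplx(Φ0 + TΨ)`, `ψ = cplx Ψ`. [cite: BalabanImbrieJaffe1988, (3.29) p.270] -/
theorem scalarForms_ops330_eq (Φ0 : E (Balaban1983to89.Site P j)) (Ψ : E (Balaban1983to89.Site P (j + 1))) :
    BIJ88ScalarTransl582.scalarForms κ (ops330 Λ Λ₇ Λ₈' κ c U M ρ cube lam ζ'').Λ8 (ops330 Λ Λ₇ Λ₈' κ c U M ρ cube lam ζ'').Δ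
        (ops330 Λ Λ₇ Λ₈' κ c U M ρ cube lam ζ'').Q (Φ0 + (ops330 Λ Λ₇ Λ₈' κ c U M ρ cube lam ζ'').T Ψ) Ψ =
      (1 / 2) * ∑ b : PBond P j, ‖covD c (cfg U) (cplx (WithLp.ofLp (Φ0 + (ops330 Λ Λ₇ Λ₈' κ c U M ρ cube lam ζ'').T Ψ))) b‖ ^ 2 +
        (1 / 2) * κ * ∑ y, ‖cplx (WithLp.ofLp Ψ) y - qCov U (cplx (WithLp.ofLp (Φ0 + (ops330 Λ Λ₇ Λ₈' κ c U M ρ cube lam ζ'').T Ψ))) y‖ ^ 2 := by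
  set Φ := Φ0 + (ops330 Λ Λ₇ Λ₈' κ c U M ρ cube lam ζ'').T Ψ with hΦ
  show (1 / 2) * ⟪Φ, RL (lapU c U) Φ⟫ + (1 / 2) * κ * ⟪Ψ - RL (qMatT U 1) Φ, Ψ - RL (qMatT U 1) Φ⟫ = _
  rw [inner_RL, form_lapU, Complex.ofReal_re, inner_self_eq_sum_norm_sq, WithLp.ofLp_sub, cplx_sub, cplx_ofLp_RL]
  congr 2
  refine Finset.sum_congr rfl fun y _ => ?_
  rw [Pi.sub_apply, qMatT_mulVec, qCovK_one]

/-- kernel: the two basic forms of p02's `eq331` at the instance, in complex coordinates, ARE r18's typed (3.31) `basicForms331` at the kernels of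
record (`nOp κ c u₁ 1 univ`, p31's `deltaLocT κ c u₁ 1 …`). [cite: BalabanImbrieJaffe1988, (3.31) p.270] -/
theorem basicForms_ops330_eq (Φ0 : E (Balaban1983to89.Site P j)) (Ψ : E (Balaban1983to89.Site P (j + 1))) :
    (1 / 2) * ⟪Φ0, (ops330 Λ Λ₇ Λ₈' κ c U M ρ cube lam ζ'').Δ Φ0 + κ • (ops330 Λ Λ₇ Λ₈' κ c U M ρ cube lam ζ'').P Φ0⟫ +
        (1 / 2) * ⟪(ops330 Λ Λ₇ Λ₈' κ c U M ρ cube lam ζ'').Λ8' Ψ,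
          (ops330 Λ Λ₇ Λ₈' κ c U M ρ cube lam ζ'').deltaLloc ((ops330 Λ Λ₇ Λ₈' κ c U M ρ cube lam ζ'').Λ8' Ψ)⟫ =
      basicForms331 (nOp κ c U 1 univ) (deltaLocT κ c U 1 cube lam ζ'') Λ₈' (cplx (WithLp.ofLp Φ0)) (cplx (WithLp.ofLp Ψ)) := by
  classical
  rw [deltaLloc_eq_RL_deltaLocT]
  show (1 / 2) * ⟪Φ0, RL (lapU c U) Φ0 + κ • RL (pOp U) Φ0⟫ + (1 / 2) * ⟪RL (proj Λ₈') Ψ, RL (deltaLocT κ c U 1 cube lam ζ'') (RL (proj Λ₈') Ψ)⟫ = _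
  have hop : RL (lapU c U) Φ0 + κ • RL (pOp U) Φ0 = RL (nOp κ c U 1 univ) Φ0 := by
    rw [nOp_univ_eq_op240, op240, RL_add, RL_smul, LinearMap.add_apply, LinearMap.smul_apply]
  have hproj : cplx (WithLp.ofLp (RL (proj Λ₈') Ψ)) = fun x => if x ∈ Λ₈' then cplx (WithLp.ofLp Ψ) x else 0 := by
    rw [cplx_ofLp_RL]
    funext x
    exact proj_mulVec Λ₈' _ x
  rw [hop, inner_RL, inner_RL, hproj, basicForms331, sum_sum_conj_mul_eq, sum_sum_restrict_eq]

/-- **(3.29) → (3.30) → (3.31) ON THE TORUS, AT THE OBJECTS OF RECORD.**  For every `U(1)` field `u₁ = cfg U` on the unit torus `T^{(j)}`, every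
fluctuation field `φ⁰` and block field `ψ`, with `κ = aL⁻²` and the translated field of (3.30) `φ = phi330 Λ₇ a L φ⁰ (corr330 Λ κ c u₁ M ρ ψ)`
(r18's typed translation at my gen-34 composed correction `C^{(0)}_{Λ,loc}(u₁)Q(u₁)*ψ`): the scalar-field forms of (3.29) at `u₁`,
`½Σ_b‖(D_{u₁}φ)(b)‖² + ½κΣ_y‖ψ(y) − (Q(u₁)φ)(y)‖²`, EQUAL r18's typed basic forms (3.31) `basicForms331 (−Δ_{u₁} + κQ(u₁)*Q(u₁)) (Δ_{1,loc}(u₁)) Λ₈′ φ⁰ ψ`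
at the kernels of record (p31's `nOp κ c u₁ 1 univ`, `deltaLocT κ c u₁ 1 cube lam ζ″`) PLUS the neglected terms `negl331` (p02's `𝒬₅ + 𝒬₆ +
⟨φ⁰, w₆ψ⟩ + ½⟨ψ, w₇ψ⟩` at the instance) — p02's `BIJ88BasicForms331.eq331` on the abstract `Ops` carrier, instantiated by `ops330` / `ops330_laws`.
[cite: BalabanImbrieJaffe1988, (3.31) p.270] -/
theorem eq331_torus (a L : ℝ) (φ0 : Balaban1983to89.Site P j → ℂ) (ψ : Balaban1983to89.Site P (j + 1) → ℂ) :
    (1 / 2) * ∑ b : PBond P j,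
          ‖covD c (cfg U) (phi330 Λ₇ a L φ0 (corr330 Λ (a * L ^ (-(2 : ℤ))) c U M ρ ψ)) b‖ ^ 2 +
        (1 / 2) * (a * L ^ (-(2 : ℤ))) *
          ∑ y, ‖ψ y - qCov U (phi330 Λ₇ a L φ0 (corr330 Λ (a * L ^ (-(2 : ℤ))) c U M ρ ψ)) y‖ ^ 2 =
      basicForms331 (nOp (a * L ^ (-(2 : ℤ))) c U 1 univ) (deltaLocT (a * L ^ (-(2 : ℤ))) c U 1 cube lam ζ'') Λ₈' φ0 ψ +
        negl331 Λ Λ₇ Λ₈' (a * L ^ (-(2 : ℤ))) c U M ρ cube lam ζ'' φ0 ψ := by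
  have h := BIJ88BasicForms331.eq331 (ops330 Λ Λ₇ Λ₈' (a * L ^ (-(2 : ℤ))) c U M ρ cube lam ζ'')
    (ops330_laws Λ Λ₇ Λ₈' _ c U M ρ cube lam ζ'') rfl (toE φ0) (toE ψ)
  have ha : (ops330 Λ Λ₇ Λ₈' (a * L ^ (-(2 : ℤ))) c U M ρ cube lam ζ'').a = a * L ^ (-(2 : ℤ)) := rfl
  rw [ha, basicForms_ops330_eq, scalarForms_ops330_eq, cplx_transl_eq_phi330, cplx_ofLp_toE, cplx_ofLp_toE] at h
  rw [h, negl331]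

/-- **THE SAME WITH THE LEFT SIDE LITERALLY p30's (3.29) RECORD** (`c = 1`): r18's typed (3.29) forms `scalarForms a L Q lapForm u φ ψ` at the
record slots `Q = qRec`, `lapForm = lapRec` (`BIJ88ScalarForms329Record`), at `u = cfg U` and the translated field (3.30), EQUAL r18's (3.31)
`basicForms331 … φ⁰ ψ + negl331 …`. [cite: BalabanImbrieJaffe1988, (3.31) p.270] -/
theorem eq331_record (a L : ℝ) (φ0 : Balaban1983to89.Site P j → ℂ) (ψ : Balaban1983to89.Site P (j + 1) → ℂ) :
    BIJ88Sect3Translations.scalarForms a L qRec lapRec (cfg U)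
        (phi330 Λ₇ a L φ0 (corr330 Λ (a * L ^ (-(2 : ℤ))) 1 U M ρ ψ)) ψ =
      basicForms331 (nOp (a * L ^ (-(2 : ℤ))) 1 U 1 univ) (deltaLocT (a * L ^ (-(2 : ℤ))) 1 U 1 cube lam ζ'') Λ₈' φ0 ψ +
        negl331 Λ Λ₇ Λ₈' (a * L ^ (-(2 : ℤ))) 1 U M ρ cube lam ζ'' φ0 ψ := by
  rw [scalarForms_record_cfg, ← eq331_torus]
  ring

end Main

/-! ## §5  Kernel formulas for two of the neglected kernels: `w₆` and `w₇″` -/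

section Kernels

variable {P : Params} {j : ℕ} {ι : Type*} [Fintype ι]
variable (Λ Λ₇ : Finset (Balaban1983to89.Site P j)) (Λ₈' : Finset (Balaban1983to89.Site P (j + 1))) (κ c : ℝ) (U : GaugeField P j U1)
  (M : ℕ) (ρ : ℝ) (cube : ι → Finset (Balaban1983to89.Site P j))
  (lam : ι → Balaban1983to89.Site P j → Balaban1983to89.Site P j → ℝ) (ζ'' : Balaban1983to89.Site P j → Balaban1983to89.Site P j → ℝ)

/-- **The kernel of `w₆` at the first step** (p02's `w6 = (Λ8ΔΛ8T − a·Qst(1 − QT))Λ8'` at `Λ8 = I`, `T = κ·1_{Λ₇}C^{(0)}_{Λ,loc}Q(u₁)ᴴ`, read as ONE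
complex kernel `T^{(j+1)} → T^{(j)}`): `−Δ_{u₁}·κ(1_{Λ₇}C_{Λ,loc}Qᴴ1_{Λ₈′}) − κ·Qᴴ(1_{Λ₈′} − Q·κ(1_{Λ₇}C_{Λ,loc}Qᴴ1_{Λ₈′}))`; its regrouped print shape
`κ[(−Δ_{u₁} + κQᴴQ)1_{Λ₇}C_{Λ,loc} − 1]Qᴴ1_{Λ₈′}` is `w6Ker_eq`. [cite: BalabanImbrieJaffe1988, (3.31) p.270] -/
def w6Ker : Matrix (Balaban1983to89.Site P j) (Balaban1983to89.Site P (j + 1)) ℂ :=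
  lapU c U * ((κ : ℂ) • (proj Λ₇ * cLocC Λ (nOp κ c U 1 univ) M ρ * (qMatT U 1)ᴴ * proj Λ₈'))
    - (κ : ℂ) • ((qMatT U 1)ᴴ * (proj Λ₈' - qMatT U 1 * ((κ : ℂ) • (proj Λ₇ * cLocC Λ (nOp κ c U 1 univ) M ρ * (qMatT U 1)ᴴ * proj Λ₈'))))

/-- kernel: **p02's `w6` at the instance is `RL w6Ker`**. [cite: BalabanImbrieJaffe1988, (3.31) p.270] -/
theorem w6_eq_RL : (ops330 Λ Λ₇ Λ₈' κ c U M ρ cube lam ζ'').w6 = RL (w6Ker Λ Λ₇ Λ₈' κ c U M ρ) := by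
  refine eq_RL_of_cplx _ _ fun x => ?_
  show cplx (WithLp.ofLp (BIJ88ScalarSummary583.crossOp κ LinearMap.id (RL (lapU c U)) (RL (qMatT U 1)) (RL (qMatT U 1)ᴴ)
      (ops330 Λ Λ₇ Λ₈' κ c U M ρ cube lam ζ'').T (RL (proj Λ₈') x))) = _
  simp only [BIJ88ScalarSummary583.crossOp_apply, LinearMap.id_coe, id_eq, WithLp.ofLp_sub, WithLp.ofLp_smul, cplx_sub, cplx_smul,
    cplx_ofLp_RL, cplx_T_apply, w6Ker, Matrix.sub_mulVec, Matrix.mulVec_sub, Matrix.smul_mulVec, Matrix.mulVec_smul,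
    ← Matrix.mulVec_mulVec]

/-- **`⟨φ⁰, w₆ψ⟩` AS A KERNEL PAIRING**: `⟨φ⁰, w₆ψ⟩ = Re φ⁰ᴴ·w6Ker·ψ`. [cite: BalabanImbrieJaffe1988, (3.31) p.270] -/
theorem inner_w6_eq (φ0 : Balaban1983to89.Site P j → ℂ) (ψ : Balaban1983to89.Site P (j + 1) → ℂ) :
    ⟪toE φ0, (ops330 Λ Λ₇ Λ₈' κ c U M ρ cube lam ζ'').w6 (toE ψ)⟫ = (star φ0 ⬝ᵥ (w6Ker Λ Λ₇ Λ₈' κ c U M ρ *ᵥ ψ)).re := by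
  rw [w6_eq_RL, inner_RL, cplx_ofLp_toE, cplx_ofLp_toE]

/-- **the print shape of the `w₆` kernel**: `w6Ker = κ[(−Δ_{u₁} + κQ(u₁)ᴴQ(u₁))·1_{Λ₇}·C^{(0)}_{Λ,loc}(u₁) − 1]·Q(u₁)ᴴ·1_{Λ₈′}` — zero exactly when
the translation inverts `−Δ_{u₁} + κP` on the range of `Qᴴ1_{Λ₈′}` (*"(5.8.1) would eliminate entirely the linear term were it not for the
localizations"*, p. 295; cf. `w6Ker_shape_exact`). [cite: BalabanImbrieJaffe1988, (3.31) p.270] -/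
theorem w6Ker_eq : w6Ker Λ Λ₇ Λ₈' κ c U M ρ =
    (κ : ℂ) • ((nOp κ c U 1 univ * (proj Λ₇ * cLocC Λ (nOp κ c U 1 univ) M ρ) - 1) * (qMatT U 1)ᴴ * proj Λ₈') := by
  unfold w6Ker
  set CL := cLocC Λ (nOp κ c U 1 univ) M ρ
  rw [nOp_univ_eq_op240, op240, pOp]
  simp only [Matrix.add_mul, Matrix.sub_mul, Matrix.mul_sub, Matrix.smul_mul, Matrix.mul_smul, Matrix.one_mul,
    Matrix.mul_assoc, smul_add, smul_sub, smul_smul]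
  abel

/-- *"(5.8.1) would eliminate entirely the linear term were it not for the localizations"* AT KERNEL LEVEL: in the print shape of `w6Ker`, with
no translation cut (`Λ₇ = T`) and an exact right inverse `C` of `−Δ_{u₁} + κQᴴQ` in place of `C_{Λ,loc}`, the kernel VANISHES.
[cite: BalabanImbrieJaffe1988, (5.8.1) p.295] -/
theorem w6Ker_shape_exact {C : Matrix (Balaban1983to89.Site P j) (Balaban1983to89.Site P j) ℂ} (hC : nOp κ c U 1 univ * C = 1) :
    (κ : ℂ) • ((nOp κ c U 1 univ * (proj (univ : Finset (Balaban1983to89.Site P j)) * C) - 1) * (qMatT U 1)ᴴ * proj Λ₈') = 0 := by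
  have hproj : proj (univ : Finset (Balaban1983to89.Site P j)) = 1 := by
    unfold proj
    rw [← diagonal_one]
    congr 1
    funext x
    rw [if_pos (mem_univ x)]
  rw [hproj, Matrix.one_mul, hC, sub_self, Matrix.zero_mul, Matrix.zero_mul, smul_zero]

/-- **The kernel of `w₇″` at the first step** (p02's `w7'' = Λ8' ∘ locDefect ∘ Λ8'`, `locDefect = a²Q(C − Cloc)Q* − ak²Q1(G − Gloc)Q1*`, read as
ONE complex kernel on `T^{(j+1)}` at `a = ak = κ`, `Q1 = Q(u₁)`, `G = C = C^{(0)}(u₁)`): `1_{Λ₈′}[κ²Q(C^{(0)} − C^{(0)}_{Λ,loc})Qᴴ1_{Λ₈′} −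
κ²Q(C^{(0)} − G_{1,loc})Qᴴ1_{Λ₈′}]`; its print shape `κ²1_{Λ₈′}Q(G_{1,loc} − C_{Λ,loc})Qᴴ1_{Λ₈′}` is `w7''Ker_eq`. [cite: BalabanImbrieJaffe1988, (3.31) p.270] -/
def w7''Ker : Matrix (Balaban1983to89.Site P (j + 1)) (Balaban1983to89.Site P (j + 1)) ℂ :=
  proj Λ₈' * (((κ ^ 2 : ℝ) : ℂ) • (qMatT U 1 * (((nOp κ c U 1 univ)⁻¹ - cLocC Λ (nOp κ c U 1 univ) M ρ) * ((qMatT U 1)ᴴ * proj Λ₈')))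
      - ((κ ^ 2 : ℝ) : ℂ) • (qMatT U 1 * (((nOp κ c U 1 univ)⁻¹ - gLocT κ c U 1 cube lam ζ'') * ((qMatT U 1)ᴴ * proj Λ₈'))))

/-- kernel: **p02's `w7''` at the instance is `RL w7''Ker`**. [cite: BalabanImbrieJaffe1988, (3.31) p.270] -/
theorem w7''_eq_RL : (ops330 Λ Λ₇ Λ₈' κ c U M ρ cube lam ζ'').w7'' = RL (w7''Ker Λ Λ₈' κ c U M ρ cube lam ζ'') := by
  refine eq_RL_of_cplx _ _ fun x => ?_
  show cplx (WithLp.ofLp (RL (proj Λ₈') (BIJ88ScalarSummary583.locDefect κ κ (RL (qMatT U 1)) (RL (nOp κ c U 1 univ)⁻¹)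
      (RL (cLocC Λ (nOp κ c U 1 univ) M ρ)) (RL (qMatT U 1)ᴴ) (RL (qMatT U 1)) (RL (nOp κ c U 1 univ)⁻¹)
      (RL (gLocT κ c U 1 cube lam ζ'')) (RL (qMatT U 1)ᴴ) (RL (proj Λ₈') x)))) = _
  simp only [BIJ88ScalarSummary583.locDefect, LinearMap.sub_apply, LinearMap.smul_apply, LinearMap.comp_apply, WithLp.ofLp_sub,
    WithLp.ofLp_smul, cplx_sub, cplx_smul, cplx_ofLp_RL, w7''Ker, Matrix.sub_mulVec, Matrix.mulVec_sub, Matrix.smul_mulVec,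
    Matrix.mulVec_smul, ← Matrix.mulVec_mulVec]

/-- **`⟨ψ, w₇″ψ⟩` AS A KERNEL PAIRING**: `⟨ψ, w₇″ψ⟩ = Re ψᴴ·w7''Ker·ψ`. [cite: BalabanImbrieJaffe1988, (3.31) p.270] -/
theorem inner_w7''_eq (ψ : Balaban1983to89.Site P (j + 1) → ℂ) :
    ⟪toE ψ, (ops330 Λ Λ₇ Λ₈' κ c U M ρ cube lam ζ'').w7'' (toE ψ)⟫ = (star ψ ⬝ᵥ (w7''Ker Λ Λ₈' κ c U M ρ cube lam ζ'' *ᵥ ψ)).re := by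
  rw [w7''_eq_RL, inner_RL, cplx_ofLp_toE]

/-- **the print shape of the `w₇″` kernel**: `w7''Ker = κ²·1_{Λ₈′}·Q(u₁)·(G_{1,loc}(u₁) − C^{(0)}_{Λ,loc}(u₁))·Q(u₁)ᴴ·1_{Λ₈′}` — at the first step the
localization defect of the identity of [7] is the DIFFERENCE OF THE TWO LOCALIZATIONS of the one propagator `C^{(0)}(u₁) = G^η_1(u₁)` (the
random-walk one (2.43) in the translation, the cube-Neumann one (2.27)–(2.28) in `Δ^L_{1,loc}`). [cite: BalabanImbrieJaffe1988, (3.31) p.270] -/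
theorem w7''Ker_eq : w7''Ker Λ Λ₈' κ c U M ρ cube lam ζ'' =
    ((κ ^ 2 : ℝ) : ℂ) • (proj Λ₈' * qMatT U 1 * (gLocT κ c U 1 cube lam ζ'' - cLocC Λ (nOp κ c U 1 univ) M ρ) * (qMatT U 1)ᴴ * proj Λ₈') := by
  unfold w7''Ker
  simp only [Matrix.mul_sub, Matrix.sub_mul, Matrix.mul_smul, Matrix.mul_assoc, smul_sub]
  abel

/-- With the SAME localization on both sides (`G_{1,loc} = C_{Λ,loc}`) the `w₇″` kernel vanishes (p02's `locDefect_eq_zero` at kernel level).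
[cite: BalabanImbrieJaffe1988, (3.31) p.270] -/
theorem w7''Ker_eq_zero_of_eq (h : gLocT κ c U 1 cube lam ζ'' = cLocC Λ (nOp κ c U 1 univ) M ρ) :
    w7''Ker Λ Λ₈' κ c U M ρ cube lam ζ'' = 0 := by
  rw [w7''Ker_eq, h, sub_self, Matrix.mul_zero, Matrix.zero_mul, Matrix.zero_mul, smul_zero]

end Kernels

end

end Literature.MathematicalPhysics.QuantumFieldTheory.BalabanImbrieJaffe1984to88.BIJ88BasicForms331OpsTorus
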